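import Summits.ResolutionOfSingularities.ResolutionOfSingularities.Theses.Valuative
import Summits.ResolutionOfSingularities.ResolutionOfSingularities.Theorems.RegularBlowupsDesingularization
import Literature.AlgebraicGeometry.Resolution.ProperModelsPatching
import Literature.AlgebraicGeometry.Resolution.ZariskiPatchingProperModels
import Literature.AlgebraicGeometry.Resolution.ProjectiveBirationalBlowup
import Literature.AlgebraicGeometry.Resolution.EmbeddedResolutionExcellentSurfaces
import HarnessLib

/-!
# Crux `PatchingRel` (stmt-ResolutionOfSingularities-0642) — crux-ideate round 2, ideator 5:
# first lemmas of the idea card `bad-stratum-induction`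

The tree PROVES Zariski–Piltant two-model patching in transcendence degree 3 from principalization
ALONE (`ProjModel.twoModelPatching_of_principalization`, `BadCurveInduction.lean` /
`BadCurveStep.lean`, modulo the named fact `CossartPiltant2019Principalization`): bad codimension-2
points are removed one at a time by principalizing the ideal of the bad curve on the regular open
`U` and re-joining, the measure being Zariski's count of iterated quadratic transforms without
centre (Abhyankar's factorization + finiteness of the base tree of a 2-dimensional regular local
ring — both dimension-free). The idea: run THE SAME architecture in transcendence degree `n` with
Axiom 4 := `PrincipalizationInChar` and, as the device that keeps the bad locus enumerable, an
embedded resolution of the bad `(n-2)`-folds (`EmbResCodimTwo`, CJS 2020 Thm. 1.4 conclusion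
shape; dimension `≤ 4` is CJS itself) so that each step blows up a REGULAR centre. The one new
phenomenon in trdeg `≥ 4` — bad points arising over the intermediate (neither generic nor closed)
points of a bad subvariety — is the internal termination lemma of the stub `BadStratumPatching`.
The composition `patchingRel_of_badStratumInduction` is kernel-checked over the tree's
dimension-free Zariski programme `resolutionInChar_of_properTwoModelPatching_of_relLU`; the
antecedent `LUrel_p` of the crux is consumed there (Piltant's Axiom 5), so the line honours
Disproof §1 (`¬PatchingRel ↔ ∃ p, LUrel_p ∧ ¬Res_p`: LU must be used).
-/

noncomputable section

namespace Summit.ResolutionOfSingularities.ResolutionOfSingularities.Cruxes.PatchingRel.BadStratumInduction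

open CategoryTheory CategoryTheory.Limits AlgebraicGeometry TopologicalSpace
open Literature.AlgebraicGeometry.Resolution
open Scheme.IdealSheafData

universe u

/-- **Axiom 3 in transcendence degree `n` — embedded resolution in codimension `≥ 2`**
(Cossart–Jannsen–Saito 2020, Thm. 1.4 with `B = ∅`, conclusion shape of the tree's
`CossartJannsenSaito2020Embedded.of_isClosed`, for closed subsets of codimension `≥ 2` of a
regular variety over a field of characteristic `p`): for `Z` regular integral separated of finite
type over `k` and `X ⊆ Z` closed with `dim X + 2 ≤ dim Z` there is `π : Z₁ ⟶ Z` proper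
surjective, a composite of blow-ups in regular centres over `X` (`IsEmbeddedTransform`), an
isomorphism over `Z ∖ X`, with `Z₁` regular, the iterated strict transform `X₁` regular, `B₁` a
strict normal crossings divisor, `π⁻¹ X = X₁ ∪ B₁` and `X₁` transversal with `B₁` — in
particular `X₁` is "stably permissible" in the sense of Piltant 2013, Def. 2.2. KNOWN for
`dim Z ≤ 4` (then `dim X ≤ 2`: CJS Thm. 1.4, any regular excellent ambient scheme); OPEN for
`dim Z ≥ 5` (embedded resolution of threefolds). -/
def EmbResCodimTwo (p : ℕ) : Prop :=
  ∀ (k : Type u) [Field k] [CharP k p] (Z : Scheme.{u}) (f : Z ⟶ Spec (.of k)) [IsNoetherian Z],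
    IsSeparated f → LocallyOfFiniteType f → QuasiCompact f → IsIntegral Z → Scheme.IsRegular Z →
    ∀ (X : Set Z), IsClosed X → topologicalKrullDim X + 2 ≤ topologicalKrullDim Z →
      ∃ (Z₁ : Scheme.{u}) (π : Z₁ ⟶ Z) (X₁ B₁ : Set Z₁),
        IsEmbeddedTransform X X π X₁ ∧
        Scheme.IsRegular Z₁ ∧ IsProper π ∧ Function.Surjective π ∧
        (∃ U : Z.Opens, (U : Set Z) = Xᶜ ∧ IsIso (π ∣_ U)) ∧
        Scheme.IsRegular (vanishingIdeal ⟨closure X₁, isClosed_closure⟩).subscheme ∧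
        IsStrictNormalCrossingsDivisor Z₁ B₁ ∧
        π ⁻¹' X = X₁ ∪ B₁ ∧
        IsTransversalWith Z₁ X₁ B₁

/-- **Zariski's bad-stratum induction in transcendence degree `n`** (the tree's
`ProjModel.twoModelPatching_of_principalization` / `exists_regLe_pair_over` / `exists_step` of
`BadCurveInduction.lean`, `BadCurveStep.lean`, PROVED for trdeg 3, re-run in trdeg `n`): two-model
patching of proper models from (a) Axiom 4 = `PrincipalizationInChar` (used three times per step
exactly as in trdeg 3: Step 2 on `B`, the ideal of the bad subvariety on `U`, Step 5 on `U₂`; plus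
ONCE at the start to PURIFY the fundamental locus over `U` to codimension 2 — replace `B` by the
`Reg B`-principalization of `I_C 𝒪_B` for a pure-codimension-2 closed `C ⊇ F_η`), (b) Abhyankar's
factorization and the finite base tree at the bad codimension-2 points (`AbhyankarQuadratic
Factorization_holds`, `finite_baseTree`: statements about 2-dimensional regular local rings with
infinite residue field, dimension-free), (c) `EmbResCodimTwo` to make the bad `(n-2)`-fold
`cl{x} ∩ U` regular with normal crossings before it is blown up, so that the step is the blow-up
of a REGULAR centre (uniform `ℙ^{c-1}`-fibres) and the new bad points — which in trdeg `≥ 4` can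
sit over the INTERMEDIATE points `y ∈ cl{x} ∩ U`, `3 ≤ dim 𝒪_{A,y} ≤ n-1`, a phenomenon absent in
trdeg 3 where `cl{x}` has only its generic point and closed points — are generic points of
fibres over finitely many codimension-1 points of the centre, and (d) `Liu2002Thm8124Projective`
(projective birational ⇒ blowing up; proper ↔ projective models by Chow). The internal open
lemma is TERMINATION: a well-founded refinement of Zariski's measure `N_η = Σ_x n_x` that also
decreases when new bad points appear over intermediate points (candidate: lexicographic in the
dimension of the exit set `cl(F_η ∩ U) ∩ Σ₁` and the QT counts). This `def` is the registered
stub the line must PROVE; every resolution-theoretic input is displayed as a hypothesis. -/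
def BadStratumPatching (p : ℕ) : Prop :=
  Liu2002Thm8124Projective.{u} → PrincipalizationInChar.{u} p → EmbResCodimTwo.{u} p →
    ProperModel.TwoModelPatching.{u} p

/-- **Composition (kernel-checked): the line concludes the crux BY NAME.** Zariski's programme in
the tree (`resolutionInChar_of_properTwoModelPatching_of_relLU`: finite resolving system from
`LUrel_p` by quasi-compactness of the Zariski–Riemann space, then `n-1` two-model patchings)
turns `BadStratumPatching` + `Liu` + `PrincipalizationInChar` + `EmbResCodimTwo` into
`Valuative.PatchingRel`; the crux's antecedent `LUrel_p` is Piltant's Axiom 5 and is consumed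
here. No bad-points hypothesis (`RegularBlowupExcAdmissibleResolution → …SingAdmissible…`) is
needed: bad points are removed inside `BadStratumPatching` by Lemma 5.6. -/
theorem patchingRel_of_badStratumInduction
    (hPil : ∀ p : ℕ, p.Prime → BadStratumPatching.{0} p)
    (hL : Liu2002Thm8124Projective.{0})
    (hP : ∀ p : ℕ, p.Prime → PrincipalizationInChar.{0} p)
    (hE : ∀ p : ℕ, p.Prime → EmbResCodimTwo.{0} p) :
    Summit.ResolutionOfSingularities.ResolutionOfSingularities.Theses.Valuative.PatchingRel := by
  intro p hp hLU
  exact resolutionInChar_of_properTwoModelPatching_of_relLU (hPil p hp hL (hP p hp) (hE p hp)) hLU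

/-- **The dimension-4 slice of the open input is ONE statement.** In transcendence degree `4`
the bad subvarieties are surfaces, so `EmbResCodimTwo` is Cossart–Jannsen–Saito (a theorem in
print, `CossartJannsenSaito2020Embedded`), and the crux reduces — modulo `BadStratumPatching` and
theorems in print — to `PrincipalizationInChar` on regular FOURFOLDS alone. Recorded as the
statement the line will prove for the `DimGt 3` slice; here only its shape. -/
def DimFourResidual (p : ℕ) : Prop :=
  CossartJannsenSaito2020Embedded.{u} → PrincipalizationInChar.{u} p →
    ∀ (k : Type u) [Field k] [CharP k p] (K : Type u) [Field K] [Algebra k K]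
      [Algebra.EssFiniteType k K], Algebra.trdeg k K ≤ 4 →
        ∀ M₁ M₂ : ProperModel k K,
          ∃ (N : ProperModel k K) (φ₁ : N.Hom M₁) (φ₂ : N.Hom M₂), φ₁.RegLe ∧ φ₂.RegLe

end Summit.ResolutionOfSingularities.ResolutionOfSingularities.Cruxes.PatchingRel.BadStratumInduction

end
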